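import Literature.NumberTheory.EllipticCurves.TateCurve.UniformizationAlgebraic
import Literature.NumberTheory.EllipticCurves.TateCurve.UniformizationLevelMatching
import Literature.NumberTheory.EllipticCurves.TateCurve.UniformizationValues
import Literature.NumberTheory.GaloisRepresentations.HeckeCharacterProofs
import Mathlib.NumberTheory.Padics.PadicVal.Basic
import HarnessLib

/-!
# Coordinates for Greenberg's Tate-line dictionary at `p = 2`: integrality of a change of
# variables with unit `c₄`, `2`-adic valuations of rationals, `‖X(-1,q)‖ > 1`, `‖X(u,q)‖ < 1` on `|u|² = |q|`

Proof-only support file (theorems, no named facts) for the discharge of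
`Greenberg1999.twoTorsion_mem_tateLine_iff_ramifiedAtTwo` (`TwoTorsionLinesTateProofs.lean`):

* §1 (Silverman *AEC* VII.1.3 (d)) `val_u_eq_one_and_val_r_le_one_of_val_c₄`: a change of
  variables `A` between two `w`-integral Weierstrass equations with `w(c₄) = 1` on both sides has
  `w(u_A) = 1` and `w(r_A) ≤ 1` (the `b₆`/`b₈` transformation formulae; the tree's
  `val_le_one_of_smul_eq_of_val_Δ_eq_one` is the unit-discriminant version);
* §2 (Neukirch *ANT* II §2, §5) at a place `v ∋ 2` of `ℚ`: `v(2) = exp(-1)`, `ℚ_v` has no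
  primitive `8`-th root of unity (`(ζ₈ + ζ₈⁷)² = 2`), and `1 < v(x) ⟺ v₂(x) < 0` for `x ∈ ℚ`;
* §3 (Silverman *ATAEC* §V.4) `‖X(-1, q)‖ = ‖2‖⁻² > 1` when `‖2‖ < 1` (`norm_tateX_one_add`), and
  `‖X(u, q)‖ < 1` for `‖u‖² = ‖q‖` (Lemma V.4.1.2, class `W`, `tate_mem_W`), for `u` algebraic
  over the complete field (the series is summed in the complete field `K(u)`).

References: [SilvermanAEC2009] VII.1.3 (d) with III.1 Table 3.1; [SilvermanATAEC1994] §V.4,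
Lemma V.4.1.2, Thm. V.3.1 (PDF pp. 399–404); [NeukirchANT1999] Ch. II §2 and §5.
-/

noncomputable section

open scoped Classical NNReal

open NumberField IsDedekindDomain Field WeierstrassCurve
  Literature.NumberTheory.EllipticCurves Literature.NumberTheory.EllipticCurves.TateCurve
  Literature.NumberTheory.GaloisRepresentations

namespace Literature.NumberTheory.EllipticCurves.Greenberg1999

/-! ## §1 Silverman *AEC* VII.1.3 (d), valuation form with unit `c₄`: `w(u) = 1`, `w(r) ≤ 1` -/

section Integrality

variable {L : Type*} [Field L] {w : Valuation L ℝ≥0}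

/-- **Silverman *AEC* VII.1.3 (d), `c₄`-unit variant.** If `V` and `A • V` are both `w`-integral
with `w(c₄) = 1` on both sides, then `w(u_A) = 1` (`c₄' = u⁻⁴ c₄`) and `w(r_A) ≤ 1` (from the `b₆`,
`b₈` transformation formulae `u⁶b₆' = b₆ + 2rb₄ + r²b₂ + 4r³`, `u⁸b₈' = b₈ + 3rb₆ + 3r²b₄ + r³b₂ + 3r⁴`:
`w(r) > 1` would force `w(4) < 1` and `w(3) < 1`). The tree's
`val_le_one_of_smul_eq_of_val_Δ_eq_one` is the unit-discriminant version of the same argument.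
[cite: SilvermanAEC2009, VII.1 Prop. 1.3 (d) with III.1 Table 3.1] -/
theorem val_u_eq_one_and_val_r_le_one_of_val_c₄ (V : WeierstrassCurve L)
    [hV : V.IsIntegral w.integer] (A : VariableChange L) [hV' : (A • V).IsIntegral w.integer]
    (hc : w V.c₄ = 1) (hc' : w (A • V).c₄ = 1) :
    w (A.u : L) = 1 ∧ w A.r ≤ 1 := by
  have hv0 : w.Integers w.integer := Valuation.integer.integers w
  obtain ⟨X, hX⟩ := hV.integral
  obtain ⟨Y, hY⟩ := hV'.integral
  have hle : ∀ a : w.integer, w (algebraMap w.integer L a) ≤ 1 := fun a ↦ hv0.map_le_one a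
  have hnat : ∀ n : ℕ, w (n : L) ≤ 1 := fun n ↦ by
    rw [← map_natCast (algebraMap w.integer L) n]; exact hle _
  have hu0 : (A.u : L) ≠ 0 := A.u.ne_zero
  -- `w u = 1`
  have hu : w (A.u : L) = 1 := by
    have h := congrArg w (variableChange_c₄ V A)
    rw [hc', map_mul, hc, mul_one, map_pow, Units.val_inv_eq_inv_val, map_inv₀] at h
    have h' : (w (A.u : L))⁻¹ = 1 := (pow_eq_one_iff_of_nonneg zero_le (by norm_num)).mp h.symm
    exact inv_eq_one.mp h'
  refine ⟨hu, ?_⟩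
  have wu : ∀ n : ℕ, w ((A.u : L) ^ n) = 1 := fun n ↦ by rw [map_pow, hu, one_pow]
  have h6 : (A.u : L) ^ 6 * (A • V).b₆ = V.b₆ + 2 * A.r * V.b₄ + A.r ^ 2 * V.b₂ + 4 * A.r ^ 3 := by
    rw [variableChange_b₆, Units.val_inv_eq_inv_val, ← mul_assoc, ← mul_pow, mul_inv_cancel₀ hu0,
      one_pow, one_mul]
  have h8 : (A.u : L) ^ 8 * (A • V).b₈ =
      V.b₈ + 3 * A.r * V.b₆ + 3 * A.r ^ 2 * V.b₄ + A.r ^ 3 * V.b₂ + 3 * A.r ^ 4 := by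
    rw [variableChange_b₈, Units.val_inv_eq_inv_val, ← mul_assoc, ← mul_pow, mul_inv_cancel₀ hu0,
      one_pow, one_mul]
  have wb : ∀ (Z : WeierstrassCurve w.integer),
      w (Z.baseChange L).b₂ ≤ 1 ∧ w (Z.baseChange L).b₄ ≤ 1 ∧ w (Z.baseChange L).b₆ ≤ 1 ∧
      w (Z.baseChange L).b₈ ≤ 1 := by
    intro Z
    simp only [WeierstrassCurve.baseChange, map_b₂, map_b₄, map_b₆, map_b₈]
    exact ⟨hle _, hle _, hle _, hle _⟩
  obtain ⟨hb₂, hb₄, hb₆, hb₈⟩ := wb X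
  obtain ⟨-, -, hb₆', hb₈'⟩ := wb Y
  rw [← hX] at hb₂ hb₄ hb₆ hb₈
  rw [← hY] at hb₆' hb₈'
  by_contra hr
  rw [not_le] at hr
  set ρ := w A.r with hρ
  have hρ1 : 1 ≤ ρ := hr.le
  have hρpow : ∀ {m n : ℕ}, m ≤ n → ρ ^ m ≤ ρ ^ n := fun h ↦ pow_le_pow_right₀ hρ1 h
  have hρ1pow : ∀ n : ℕ, (1 : ℝ≥0) ≤ ρ ^ n := fun n ↦ one_le_pow₀ hρ1
  have wr : ∀ n : ℕ, w (A.r ^ n) = ρ ^ n := fun n ↦ by rw [map_pow]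
  have e4 : (4 : L) * A.r ^ 3 =
      (A.u : L) ^ 6 * (A • V).b₆ - V.b₆ - 2 * A.r * V.b₄ - A.r ^ 2 * V.b₂ := by
    linear_combination -h6
  have i4 : w (4 : L) * ρ ^ 3 ≤ ρ ^ 2 := by
    have : w ((4 : L) * A.r ^ 3) ≤ ρ ^ 2 := by
      rw [e4]
      refine Valuation.map_sub_le _ (Valuation.map_sub_le _ (Valuation.map_sub_le _ ?_ ?_) ?_) ?_
      · rw [map_mul, wu, one_mul]; exact le_trans hb₆' (hρ1pow 2)
      · exact le_trans hb₆ (hρ1pow 2)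
      · rw [map_mul, map_mul]
        calc w 2 * w A.r * w V.b₄ ≤ 1 * ρ * 1 := mul_le_mul' (mul_le_mul' (hnat 2) le_rfl) hb₄
          _ = ρ ^ 1 := by ring
          _ ≤ ρ ^ 2 := hρpow (by norm_num)
      · rw [map_mul, wr]
        calc ρ ^ 2 * w V.b₂ ≤ ρ ^ 2 * 1 := mul_le_mul' le_rfl hb₂
          _ = ρ ^ 2 := mul_one _
    rwa [map_mul, wr] at this
  have e3 : (3 : L) * A.r ^ 4 = (A.u : L) ^ 8 * (A • V).b₈ - V.b₈ - 3 * A.r * V.b₆ -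
      3 * A.r ^ 2 * V.b₄ - A.r ^ 3 * V.b₂ := by
    linear_combination -h8
  have i3 : w (3 : L) * ρ ^ 4 ≤ ρ ^ 3 := by
    have : w ((3 : L) * A.r ^ 4) ≤ ρ ^ 3 := by
      rw [e3]
      refine Valuation.map_sub_le _ (Valuation.map_sub_le _ (Valuation.map_sub_le _
        (Valuation.map_sub_le _ ?_ ?_) ?_) ?_) ?_
      · rw [map_mul, wu, one_mul]; exact le_trans hb₈' (hρ1pow 3)
      · exact le_trans hb₈ (hρ1pow 3)
      · rw [map_mul, map_mul]
        calc w 3 * w A.r * w V.b₆ ≤ 1 * ρ * 1 := mul_le_mul' (mul_le_mul' (hnat 3) le_rfl) hb₆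
          _ = ρ ^ 1 := by ring
          _ ≤ ρ ^ 3 := hρpow (by norm_num)
      · rw [map_mul, map_mul, wr]
        calc w 3 * ρ ^ 2 * w V.b₄ ≤ 1 * ρ ^ 2 * 1 := mul_le_mul' (mul_le_mul' (hnat 3) le_rfl) hb₄
          _ = ρ ^ 2 := by ring
          _ ≤ ρ ^ 3 := hρpow (by norm_num)
      · rw [map_mul, wr]
        calc ρ ^ 3 * w V.b₂ ≤ ρ ^ 3 * 1 := mul_le_mul' le_rfl hb₂
          _ = ρ ^ 3 := mul_one _
    rwa [map_mul, wr] at this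
  have lt4 : w (4 : L) < 1 := by
    have : w (4 : L) * ρ ^ 3 < 1 * ρ ^ 3 := by
      calc w (4 : L) * ρ ^ 3 ≤ ρ ^ 2 := i4
        _ < ρ ^ 3 := pow_lt_pow_right₀ hr (by norm_num)
        _ = 1 * ρ ^ 3 := (one_mul _).symm
    exact lt_of_mul_lt_mul_right' this
  have lt3 : w (3 : L) < 1 := by
    have : w (3 : L) * ρ ^ 4 < 1 * ρ ^ 4 := by
      calc w (3 : L) * ρ ^ 4 ≤ ρ ^ 3 := i3
        _ < ρ ^ 4 := pow_lt_pow_right₀ hr (by norm_num)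
        _ = 1 * ρ ^ 4 := (one_mul _).symm
    exact lt_of_mul_lt_mul_right' this
  have : w ((4 : L) - 3) < 1 := lt_of_le_of_lt (Valuation.map_sub _ _ _) (max_lt lt4 lt3)
  rw [show (4 : L) - 3 = 1 by norm_num, map_one] at this
  exact lt_irrefl _ this

/-- A Weierstrass equation over a valued field whose coefficients have valuation `≤ 1` has
coefficients in the valuation ring `R = {w ≤ 1}` (Silverman *AEC* VII.1: "a Weierstrass equation
with coefficients in `R`"). [cite: SilvermanAEC2009, VII.1 (PDF p. 185), Prop. VII.1.3] -/
theorem isIntegral_of_val_le_one (V : WeierstrassCurve L) (h₁ : w V.a₁ ≤ 1)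
    (h₂ : w V.a₂ ≤ 1) (h₃ : w V.a₃ ≤ 1) (h₄ : w V.a₄ ≤ 1) (h₆ : w V.a₆ ≤ 1) :
    V.IsIntegral w.integer :=
  ⟨⟨⟨⟨V.a₁, h₁⟩, ⟨V.a₂, h₂⟩, ⟨V.a₃, h₃⟩, ⟨V.a₄, h₄⟩, ⟨V.a₆, h₆⟩⟩, by ext <;> rfl⟩⟩

end Integrality

/-! ## §2 Valuations of rationals at `v ∣ 2` -/

section Rationals

variable (v : HeightOneSpectrum (𝓞 ℚ)) (hv : ((2 : ℕ) : 𝓞 ℚ) ∈ v.asIdeal)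

include hv in
/-- At `v ∋ 2`: `natGenerator v = 2`. [folklore] -/
private theorem natGenerator_eq_two'  : Rat.HeightOneSpectrum.natGenerator v = 2 :=
  (Nat.prime_dvd_prime_iff_eq (Rat.HeightOneSpectrum.prime_natGenerator v) Nat.prime_two).mp
    ((Rat.natCast_mem_asIdeal_iff v).mp hv)

include hv in
/-- At a place `v ∋ 2` of `ℚ`: `v(2) = exp(-1)` in `ℚ_v`, i.e. `2` is a uniformiser of
`ℚ_v = ℚ₂` (Neukirch *ANT* II §2). [cite: NeukirchANT1999, Ch. II §2 (the field `ℚ_p`, `v_p(p) = 1`)] -/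
theorem valued_two : Valued.v ((2 : ℕ) : v.adicCompletion ℚ) = WithZero.exp (-1 : ℤ) := by
  rw [Rat.valued_natCast, ← natGenerator_eq_two' v hv]
  exact Rat.valuation_natGenerator v

include hv in
/-- **`ζ₈ ∉ ℚ₂`**: at a place `v ∋ 2` of `ℚ`, `ℚ_v` contains no primitive `8`-th root of unity
(`z⁴ ≠ -1`): otherwise `(z - z³)² = 2` and `v(2) = exp(-1)` would be a square in the value group
(Neukirch *ANT* II (5.7): the roots of unity of `ℚ₂` are `±1`).
[cite: NeukirchANT1999, Ch. II §5 Prop. (5.7)] -/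
theorem pow_four_ne_neg_one (z : v.adicCompletion ℚ) : z ^ 2 ^ 2 ≠ -1 := by
  intro hz
  have hz4 : z ^ 4 = -1 := by norm_num at hz; exact hz
  have hs : (z - z ^ 3) ^ 2 = ((2 : ℕ) : v.adicCompletion ℚ) := by
    have h6 : z ^ 6 = -z ^ 2 := by linear_combination z ^ 2 * hz4
    push_cast
    linear_combination (-2 : v.adicCompletion ℚ) * hz4 + h6
  have hval := congrArg Valued.v hs
  rw [map_pow, valued_two v hv] at hval
  have hs0 : Valued.v (z - z ^ 3) ≠ 0 := by
    intro h0
    rw [h0, zero_pow two_ne_zero] at hval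
    exact WithZero.coe_ne_zero hval.symm
  obtain ⟨a, ha⟩ := WithZero.ne_zero_iff_exists.mp hs0
  rw [← ha, ← WithZero.coe_pow, WithZero.exp, WithZero.coe_inj] at hval
  have h2 : (2 : ℤ) * Multiplicative.toAdd a = -1 := by
    have := congrArg Multiplicative.toAdd hval
    rw [toAdd_pow, toAdd_ofAdd, nsmul_eq_mul] at this
    exact_mod_cast this
  omega

include hv in
/-- At a place `v ∋ 2` of `ℚ`: for a rational `x`, `v(x) > 1` in `ℚ_v` iff `ord₂(x) < 0` (the
`v`-adic valuation of `ℚ` restricted from `ℚ_v` is the `2`-adic one; Neukirch *ANT* II §2).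
[cite: NeukirchANT1999, Ch. II §2] -/
theorem one_lt_valued_iff_padicValRat_neg (x : ℚ) :
    1 < Valued.v (algebraMap ℚ (v.adicCompletion ℚ) x) ↔ padicValRat 2 x < 0 := by
  haveI : Fact (Nat.Prime 2) := ⟨Nat.prime_two⟩
  have hgen : (Rat.HeightOneSpectrum.natGenerator v : ℤ) = 2 := by
    rw [natGenerator_eq_two' v hv]; rfl
  rw [Literature.NumberTheory.GaloisRepresentations.valued_algebraMap_adicCompletion v x]
  -- `x = num / den`
  have hx : (x : ℚ) = (x.num : ℚ) / (x.den : ℚ) := (Rat.num_div_den x).symm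
  have hden0 : (x.den : ℚ) ≠ 0 := by exact_mod_cast x.den_nz
  have hcop : ¬ ((2 : ℤ) ∣ x.num ∧ 2 ∣ (x.den : ℤ)) := by
    rintro ⟨hn, hd⟩
    have h2 : 2 ∣ Nat.gcd x.num.natAbs x.den :=
      Nat.dvd_gcd (Int.natCast_dvd.mp (by simpa using hn)) (by exact_mod_cast hd)
    rw [x.reduced.gcd_eq_one] at h2
    exact absurd (Nat.dvd_one.mp h2) (by norm_num)
  constructor
  · intro h
    -- `v(x) > 1` forces `2 ∣ den`, hence `2 ∤ num`, hence `padicValRat 2 x < 0`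
    by_contra hpv
    rw [not_lt] at hpv
    have hden : ¬ (2 : ℤ) ∣ (x.den : ℤ) := by
      intro hd
      have hn : ¬ (2 : ℤ) ∣ x.num := fun hn ↦ hcop ⟨hn, hd⟩
      have : padicValRat 2 x < 0 := by
        rw [padicValRat_def, padicValInt.eq_zero_of_not_dvd hn]
        have h1 : 1 ≤ padicValNat 2 x.den :=
          one_le_padicValNat_of_dvd x.den_nz (by exact_mod_cast hd)
        omega
      exact absurd hpv (not_le.mpr this)
    have hvden : v.valuation ℚ (x.den : ℚ) = 1 := by
      have := Rat.valuation_intCast_eq_one v (n := x.den) (by rwa [hgen])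
      exact_mod_cast this
    have hvnum : v.valuation ℚ (x.num : ℚ) ≤ 1 := by
      rw [Rat.valuation_intCast]; exact HeightOneSpectrum.intValuation_le_one _ _
    have : v.valuation ℚ x ≤ 1 := by
      rw [hx, map_div₀, hvden, div_one]; exact hvnum
    exact absurd h (not_lt.mpr this)
  · intro h
    have hden : (2 : ℤ) ∣ (x.den : ℤ) := by
      by_contra hd
      have hd' : ¬ 2 ∣ x.den := fun hd'' ↦ hd (by exact_mod_cast hd'')
      rw [padicValRat_def, padicValNat.eq_zero_of_not_dvd hd'] at h
      have := padicValInt.self (p := 2) one_lt_two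
      omega
    have hn : ¬ (2 : ℤ) ∣ x.num := fun hn ↦ hcop ⟨hn, hden⟩
    have hvnum : v.valuation ℚ (x.num : ℚ) = 1 :=
      Rat.valuation_intCast_eq_one v (n := x.num) (by rwa [hgen])
    have hvden : v.valuation ℚ (x.den : ℚ) < 1 := by
      have hle := Rat.valuation_intCast_le v (n := (x.den : ℤ)) (e := 1) (by rwa [hgen, pow_one])
      push_cast at hle
      exact lt_of_le_of_lt hle (by rw [← WithZero.exp_zero]; exact WithZero.exp_lt_exp.mpr (by norm_num))
    have hvden0 : v.valuation ℚ (x.den : ℚ) ≠ 0 :=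
      (Valuation.ne_zero_iff _).mpr hden0
    rw [hx, map_div₀, hvnum, one_div]
    exact one_lt_inv_iff₀.mpr ⟨zero_lt_iff.mpr hvden0, hvden⟩

end Rationals

/-! ## §3 `‖X(-1,q)‖ > 1` and `‖X(u,q)‖ < 1` on the circle `|u|² = |q|` (Silverman *ATAEC* §V.4) -/

section Norms

variable {K : Type*} [NontriviallyNormedField K] [CompleteSpace K] [IsUltrametricDist K]

/-- **`‖X(-1, q)‖ = ‖2‖⁻² > 1` at residue characteristic `2`** (Silverman *ATAEC* §V.4, PDF p. 401:
`u ≡ 1 (mod 𝔐) ⇒ ord X(u,q) < 0`, with `u = -1 = 1 + (-2)`; the tree's `norm_tateX_one_add`).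
[cite: SilvermanATAEC1994, §V.4 proof of Thm. V.3.1 (c)–(e) (PDF p. 401)] -/
theorem one_lt_norm_tateX_neg_one {q : K} (hq : ‖q‖ < 1) (h2 : ‖(2 : K)‖ < 1)
    (h20 : (2 : K) ≠ 0) : 1 < ‖tateX q (-1)‖ := by
  rw [show (-1 : K) = 1 + -2 by norm_num,
    norm_tateX_one_add hq (neg_ne_zero.mpr h20) (by rwa [norm_neg]), norm_neg]
  exact one_lt_pow₀ (one_lt_inv_iff₀.mpr ⟨norm_pos_iff.mpr h20, h2⟩) two_ne_zero

omit [IsUltrametricDist K] in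
/-- **`‖X(u, q)‖ < 1` for `‖u‖² = ‖q‖`** (Silverman *ATAEC* Lemma V.4.1.2, the class `W`: the
tree's `tate_mem_W` gives `‖Y‖² = ‖X + Y‖² = ‖q‖`), for `u` in an algebraic normed extension `F`
of the complete field `K` (the series is summed in the complete field `K(u)`).
[cite: SilvermanATAEC1994, Lemma V.4.1.2 (PDF p. 403)] -/
theorem norm_tateX_lt_one_of_norm_sq_eq {F : Type*} [NormedField F] [NormedAlgebra K F]
    [IsUltrametricDist F] [Algebra.IsAlgebraic K F] {q : K} (hq0 : q ≠ 0) (hq : ‖q‖ < 1) {u : F}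
    (hu : ‖u‖ ^ 2 = ‖q‖) : ‖tateX (algebraMap K F q) u‖ < 1 := by
  obtain ⟨E, hE, huE⟩ :=
    exists_mem_intermediateField_finiteDimensional K (Algebra.IsAlgebraic.isAlgebraic u)
  haveI := hE
  letI : NontriviallyNormedField E := IntermediateField.nontriviallyNormedField E
  haveI : CompleteSpace E := completeSpace_intermediateField K E
  haveI : IsUltrametricDist E := IntermediateField.isUltrametricDist E
  set qE : E := ⟨algebraMap K F q, E.algebraMap_mem q⟩ with hqE_def
  set uE : E := ⟨u, huE⟩ with huE_def
  have hqEn : ‖qE‖ < 1 := by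
    change ‖algebraMap K F q‖ < 1
    rwa [norm_algebraMap']
  have hqE0 : qE ≠ 0 := fun h ↦
    (map_ne_zero (algebraMap K F)).mpr hq0 (congrArg Subtype.val h)
  have huq : ‖uE‖ ^ 2 = ‖qE‖ := by
    change ‖u‖ ^ 2 = ‖algebraMap K F q‖
    rwa [norm_algebraMap']
  obtain ⟨hY, hXY⟩ := tate_mem_W hqEn hqE0 huq
  have hlt : ∀ {z : E}, ‖z‖ ^ 2 = ‖qE‖ → ‖z‖ < 1 := fun {z} hz ↦ by
    by_contra h
    rw [not_lt] at h
    have : (1 : ℝ) ≤ ‖z‖ ^ 2 := one_le_pow₀ h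
    linarith
  have hX : ‖tateX qE uE‖ < 1 := by
    have h := IsUltrametricDist.norm_add_le_max (tateX qE uE + tateY qE uE) (-tateY qE uE)
    rw [add_neg_cancel_right, norm_neg] at h
    exact lt_of_le_of_lt h (max_lt (hlt hXY) (hlt hY))
  have hmap := map_tateX (algebraMap E F) continuous_subtype_val hqEn uE
  have e1 : algebraMap E F qE = algebraMap K F q := rfl
  have e2 : algebraMap E F uE = u := rfl
  rw [e1, e2] at hmap
  rw [← hmap]
  exact hX

end Norms

end Literature.NumberTheory.EllipticCurves.Greenberg1999

end
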